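import Summits.HodgeConjecture.HodgeConjecture.Theorems.Ring2HypothesesDeligneTorus
import Summits.HodgeConjecture.HodgeConjecture.Theorems.Ring2HypothesesTannakaPricing
import Summits.HodgeConjecture.HodgeConjecture.Theorems.Ring2HypothesesCMPowerAnchors
import Literature.AlgebraicGeometry.Motives.SupersingularAbelianVariety
import Literature.AlgebraicGeometry.Motives.AbelianVarietyProductDimProofs
import HarnessLib

/-!
# Ring 2 around `HC_CM` — part XXXVI-B: TANNAKA PRICING IS ON-PATH — (P2) ⟸ `HodgeConjecture`, (P2) ⟸ `HC_AV`, and the exact price `HC_AV ⟺ (P2) ∧ [∀ A, G¹_alg(A) ≤ Hg(A)]` with both directions in the kernel (typer 2)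

HONEST FRAMING (page 1, verbatim in every file of this cell): research route conditional on HC_CM; not a
corollary; Q11.4-sentence-2 already refuted in dim ≥ 3.

`HC_CM` := `Theses.RankFourFaces.CMAbelianHodge` (item stmt-HodgeConjecture-3052), `HC_AV` :=
`Theses.PadicSemiregularLift.HodgeAbelianVarieties` (item stmt-HodgeConjecture-1333). In this file `HC_CM`, `HC_AV`,
`HodgeConjecture` and every `HodgeConjectureFor …` are BINDERS (hypotheses of implications) or CONCLUSIONS — never facts.

PROVENANCE AND PURPOSE. Part XXIII (`Ring2HypothesesTannakaPricing`) typed the hypothesis node (P2)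
`AlgebraicInvariantsPrincipleAV` («a system of rational classes on the powers of a complex abelian variety fixed by
`G¹_alg(A)(ℂ)` consists of algebraic classes») and proved `HC_AV ⟸ (P2) ∧ [∀ A, G¹_alg(A) ≤ Hg(A)]`,
`HC_CM ⟸ (P2) ∧ [∀ CM A, G¹_alg(A) ≤ Hg(A)]`; its §T5 audit recorded: «(P2) … is NOT a consequence of `HodgeConjecture`
in the kernel (that would need Deligne I Prop. 3.4's converse half "fixed by `Hg` ⟹ `(p,p)`", absent from the tree)».
Part XXXVI-A (`Ring2HypothesesDeligneTorus`) has now proved that half on the tree's carriers (van Geemen, LNM 1594,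
Thm. 6.6: rational `Hg(X)`-invariants are the Hodge classes, `hodgeGroup_le_powClassStabilizer_iff`). This file draws
the bookkeeping consequences; part XXIII §T5's sentence is hereby SUPERSEDED (it was true of the tree at the time; the
statement of (P2) is unchanged and still never asserted).

WHAT IS PROVED (no `sorry`, no new axiom, no named fact introduced; no `def`):
§D5 (P2) IS ON-PATH: `AlgebraicInvariantsPrincipleAV` ⟸ [`HC` on every scheme power of every abelian variety]
  (`algebraicInvariantsPrincipleAV_of_forall_hodgeConjectureFor_cartesianPow`: `Hg(A) ≤ G¹_alg(A)` unconditionally by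
  part XXIII's `hodgeGroup_le_algebraicStabilizer`, `≤ Stab(S)` by hypothesis, so every class of the rational system
  `S` is a Hodge class on its power by XXXVI-A §D4, hence algebraic by `HC` there) ⟸ `HodgeConjecture`
  (`algebraicInvariantsPrincipleAV_of_hodgeConjecture`) and ⟸ `HC_AV` (`algebraicInvariantsPrincipleAV_of_hc_av`, via §D6).
§D6 SCHEME POWERS = ABELIAN-VARIETY POWERS: `(A.powSucc a).X = cartesianPow A.X (a+1)` and
  `(A.powSucc a).dim = cartesianPowDim A.dim a` (`AbelianVariety.powSucc_X_eq_cartesianPow`,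
  `AbelianVariety.dim_powSucc_eq_cartesianPowDim`: both recursions are `(– ⊗ A.X)`-iterates, `AbelianVariety.prod_X`,
  `AbelianVariety.dim_prod`; part XXIII §T5 called this isomorphism "not constructed" — it is an equality), whence
  `HC_AV` gives `HC` on every scheme power (`forall_hodgeConjectureFor_cartesianPow_of_hc_av`) and `HC_CM` (BINDER) on
  every scheme power of a CM abelian variety (`forall_hodgeConjectureFor_cartesianPow_of_hc_cm`, powers of CM abelian
  varieties being CM, `isOfCMType_powSucc`, part XXX).
§D7 EXACT PRICES AT CLASS LEVEL, NO PACKAGE GRANTED: `HC_AV ⟹ ∀ A, G¹_alg(A) = Hg(A)`, `HC_CM ⟹ ∀ CM A, G¹_alg(A) = Hg(A)`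
  (`algebraicStabilizer_eq_hodgeGroup_of_hc_av`, `…_of_hc_cm`, through part XXIII's
  `algebraicStabilizer_eq_hodgeGroup_of_forall_hodgeConjectureFor`), and
  **`HC_AV ⟺ (P2) ∧ [∀ A, G¹_alg(A) ≤ Hg(A)]`** (`hodgeAbelianVarieties_iff_algebraicInvariants_and_forall_le`; ⟸ is
  part XXIII's `hodgeAbelianVarieties_of_algebraicInvariants_of_forall_le`) — «the Hodge conjecture for all powers of
  `X` is equivalent to the fullness of the realization functor» (Floccari–Fu, proof of Lemma 5.4) in its
  special-group, algebraic-classes, `ℂ`-points form, now with BOTH directions in the kernel at the class targets.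
  For `HC_CM` only the two separate implications are recorded (`hc_cm_of_algebraicInvariants_of_forall_cm_le` of part
  XXIII and `algebraicStabilizer_eq_hodgeGroup_of_hc_cm` here): (P2) restricted to CM abelian varieties is not a node
  of the axis and is not minted here.
AUDIT. Every theorem is an implication whose hypothesis is `HodgeConjecture` / `HC_AV` / `HC_CM` / `HC` on powers, or
an equality of schemes / dimensions (§D6): ON-PATH bookkeeping, no progress on the summit; (P2) keeps its status
«hypothesis node, in print as a composite, never asserted».

References (bib keys): vanGeemen1994HodgeAV (Thm. 6.6, 6.7), Deligne1982HodgeCycles (I Prop. 3.4), FloccariFu2026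
(§5, proof of Lemma 5.4, p. 13), Andre1996Motifs (§6.3 p. 31), Milne1999 (§2 p. 54, §7 (H)), Deligne2000 (§1),
GortzWedhorn2020 (Lemma 6.26, Remark 16.54).
-/

set_option linter.dupNamespace false

noncomputable section

open CategoryTheory MonoidalCategory CartesianMonoidalCategory
open Literature.AlgebraicGeometry Literature.AlgebraicGeometry.Motives
open Literature.AlgebraicGeometry.HodgeTheory Literature.AlgebraicGeometry.Milne1999
open Literature.AlgebraicTopology.SingularHomology

namespace Summit.HodgeConjecture.HodgeConjecture.Ring2.Hypotheses

open Summit.HodgeConjecture.HodgeConjecture.Ring2.ClassTargets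

/-! ## §D5 (P2) is ON-PATH -/

/-- **(P2) from `HC` on every scheme power of every abelian variety**: `Hg(A) ≤ G¹_alg(A)` unconditionally (part
XXIII `hodgeGroup_le_algebraicStabilizer`) `≤ Stab(S)` by hypothesis, so every class of the rational system `S` is a
Hodge class on its power (part XXXVI-A §D4), hence algebraic by `HC` there. [cite: vanGeemen1994HodgeAV, Thm. 6.6]
[cite: FloccariFu2026, §5 proof of Lemma 5.4 (p. 13)] -/
theorem algebraicInvariantsPrincipleAV_of_forall_hodgeConjectureFor_cartesianPow
    (hHC : ∀ (A : AbelianVariety ℂ) (a : ℕ), HodgeConjectureFor (cartesianPowDim A.dim a) (cartesianPow A.X (a + 1))) :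
    AlgebraicInvariantsPrincipleAV := by
  intro A S hS hle a p c hc
  have hX : IsSmoothProjective A.dim A.X := AbelianVariety.isSmoothProjective_holds
  exact (hHC A a).2 p c (hS a p c hc)
    (isOfHodgeType_of_hodgeGroup_le_powClassStabilizer hX ((hodgeGroup_le_algebraicStabilizer hX).trans hle) hc)

/-- **(P2) is ON-PATH: `HodgeConjecture ⟹ AlgebraicInvariantsPrincipleAV`** (supersedes part XXIII §T5's «not a
consequence in the kernel»). [cite: Deligne2000, §1] [cite: vanGeemen1994HodgeAV, Thm. 6.6] -/
theorem algebraicInvariantsPrincipleAV_of_hodgeConjecture (h : _root_.HodgeConjecture) :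
    AlgebraicInvariantsPrincipleAV :=
  algebraicInvariantsPrincipleAV_of_forall_hodgeConjectureFor_cartesianPow
    (forall_hodgeConjectureFor_cartesianPow_of_hodgeConjecture h)

/-! ## §D6 Scheme powers are the abelian-variety powers -/

/-- **`(A^{N+1}).X = A.X^{×(N+1)}`**: the underlying scheme of the abelian-variety power `A.powSucc a` IS the scheme
power `cartesianPow A.X (a + 1)` (both are the `(– ⊗ A.X)`-iterates of `A.X`; `AbelianVariety.prod_X`).
[cite: Milne1999, §2 p. 54] -/
theorem AbelianVariety.powSucc_X_eq_cartesianPow (A : AbelianVariety ℂ) :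
    ∀ a : ℕ, (A.powSucc a).X = cartesianPow A.X (a + 1)
  | 0 => rfl
  | a + 1 => by
    rw [AbelianVariety.powSucc_succ, AbelianVariety.prod_X, AbelianVariety.powSucc_X_eq_cartesianPow A a]
    rfl

/-- `dim A^{N+1} = cartesianPowDim (dim A) N` (`= (N+1) dim A`; `AbelianVariety.dim_prod`).
[cite: GortzWedhorn2020, Lemma 6.26 and Remark 16.54] -/
theorem AbelianVariety.dim_powSucc_eq_cartesianPowDim (A : AbelianVariety ℂ) :
    ∀ a : ℕ, (A.powSucc a).dim = cartesianPowDim A.dim a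
  | 0 => rfl
  | a + 1 => by
    rw [AbelianVariety.powSucc_succ, AbelianVariety.dim_prod, AbelianVariety.dim_powSucc_eq_cartesianPowDim A a]
    rfl

/-- **`HC_AV` (a BINDER) gives `HC` on every scheme power of every abelian variety.** [cite: Deligne2000, §1] -/
theorem forall_hodgeConjectureFor_cartesianPow_of_hc_av (h : Theses.PadicSemiregularLift.HodgeAbelianVarieties)
    (A : AbelianVariety ℂ) (a : ℕ) : HodgeConjectureFor (cartesianPowDim A.dim a) (cartesianPow A.X (a + 1)) := by
  have h1 := h (A.powSucc a)
  rwa [AbelianVariety.dim_powSucc_eq_cartesianPowDim, AbelianVariety.powSucc_X_eq_cartesianPow] at h1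

/-- **`HC_CM` (a BINDER) gives `HC` on every scheme power of every CM abelian variety** (powers of CM abelian
varieties are CM, `isOfCMType_powSucc`). [cite: Milne1999, §2 p. 54 and §7 (H)] -/
theorem forall_hodgeConjectureFor_cartesianPow_of_hc_cm (h : Theses.RankFourFaces.CMAbelianHodge)
    (A : AbelianVariety ℂ) (hA : IsOfCMType A) (a : ℕ) :
    HodgeConjectureFor (cartesianPowDim A.dim a) (cartesianPow A.X (a + 1)) := by
  have h1 := hcOnClass_cmType_iff_cmAbelianHodge.mpr h (A.powSucc a) (isOfCMType_powSucc hA a)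
  rwa [AbelianVariety.dim_powSucc_eq_cartesianPowDim, AbelianVariety.powSucc_X_eq_cartesianPow] at h1

/-- **(P2) ⟸ `HC_AV`.** [cite: FloccariFu2026, §5 proof of Lemma 5.4 (p. 13)] [cite: vanGeemen1994HodgeAV, Thm. 6.6] -/
theorem algebraicInvariantsPrincipleAV_of_hc_av (h : Theses.PadicSemiregularLift.HodgeAbelianVarieties) :
    AlgebraicInvariantsPrincipleAV :=
  algebraicInvariantsPrincipleAV_of_forall_hodgeConjectureFor_cartesianPow
    (forall_hodgeConjectureFor_cartesianPow_of_hc_av h)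

/-! ## §D7 Exact prices at class level, no package granted -/

/-- **`HC_AV ⟹ G¹_alg(A) = Hg(A)` for every complex abelian variety** (part XXIII's
`algebraicStabilizer_eq_hodgeGroup_of_forall_hodgeConjectureFor` fed by §D6). [cite: Andre1996Motifs, §6.3 (p. 31)]
[cite: FloccariFu2026, §5 proof of Lemma 5.4 (p. 13)] -/
theorem algebraicStabilizer_eq_hodgeGroup_of_hc_av (h : Theses.PadicSemiregularLift.HodgeAbelianVarieties)
    (A : AbelianVariety ℂ) : algebraicStabilizer A.X = hodgeGroup A.dim A.X :=
  algebraicStabilizer_eq_hodgeGroup_of_forall_hodgeConjectureFor A (forall_hodgeConjectureFor_cartesianPow_of_hc_av h A)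

/-- **`HC_CM` (BINDER) ⟹ `G¹_alg(A) = Hg(A)` for every CM abelian variety** — the converse of the bracket in part
XXIII's `hc_cm_of_algebraicInvariants_of_forall_cm_le`. [cite: Milne1999, §7 (H)] [cite: Andre1996Motifs, §6.3 (p. 31)] -/
theorem algebraicStabilizer_eq_hodgeGroup_of_hc_cm (h : Theses.RankFourFaces.CMAbelianHodge)
    (A : AbelianVariety ℂ) (hA : IsOfCMType A) : algebraicStabilizer A.X = hodgeGroup A.dim A.X :=
  algebraicStabilizer_eq_hodgeGroup_of_forall_hodgeConjectureFor A
    (forall_hodgeConjectureFor_cartesianPow_of_hc_cm h A hA)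

/-- **THE EXACT PRICE OF `HC_AV`, BOTH DIRECTIONS IN THE KERNEL: `HC_AV ⟺ (P2) ∧ [∀ A, G¹_alg(A) ≤ Hg(A)]`**
(«the Hodge conjecture for all powers ⟺ fullness of the realization functor», Floccari–Fu, proof of Lemma 5.4, at the
level of the class target; ⟸ is part XXIII's `hodgeAbelianVarieties_of_algebraicInvariants_of_forall_le`).
[cite: FloccariFu2026, §5 proof of Lemma 5.4 (p. 13)] [cite: vanGeemen1994HodgeAV, Thm. 6.6] [cite: Deligne2000, §1] -/
theorem hodgeAbelianVarieties_iff_algebraicInvariants_and_forall_le :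
    Theses.PadicSemiregularLift.HodgeAbelianVarieties ↔
      AlgebraicInvariantsPrincipleAV ∧ ∀ A : AbelianVariety ℂ, algebraicStabilizer A.X ≤ hodgeGroup A.dim A.X :=
  ⟨fun h ↦ ⟨algebraicInvariantsPrincipleAV_of_hc_av h, fun A ↦ (algebraicStabilizer_eq_hodgeGroup_of_hc_av h A).le⟩,
    fun h ↦ hodgeAbelianVarieties_of_algebraicInvariants_of_forall_le h.1 h.2⟩

end Summit.HodgeConjecture.HodgeConjecture.Ring2.Hypotheses

end
-- buildfix (ops-buildfix lane, 2026-08-20): comment-only re-land to enqueue the hub build after the Milne1999/CM chain repair (LEDGER C-7); no declaration changed.
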